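import Mathlib

/-!
# Stub `stub_exteriorSchwarz` of line `Sketch` (skeleton v6) for crux `TameOrBrodyR4` (stmt-SmoothPoincare4-7826, route SullivanDual)

Schwarz lemma at infinity. Let `f` be holomorphic on the exterior domain `{R₁ < ‖c‖}` (`0 < R₁`),
tend to `0` at infinity, and satisfy `‖f c‖ ≤ L` on the circle `‖c‖ = R₂` (`R₁ < R₂`). Then
`‖f c‖ ≤ L R₂ / ‖c‖` for all `‖c‖ ≥ R₂`.

How: pull back by the inversion `s ↦ s⁻¹`. The function `h s := f s⁻¹` (`h 0 := 0`) is holomorphic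
on the punctured disc `0 < ‖s‖ < R₁⁻¹` (composition of holomorphic maps) and continuous at `0`
(because `s⁻¹ → ∞` as `s → 0`, `s ≠ 0`, and `f → 0` at infinity), hence holomorphic on the disc
`‖s‖ < R₁⁻¹` by Riemann's removable singularity theorem
(`Complex.differentiableOn_compl_singleton_and_continuousAt_iff`) — this is
`ExteriorSchwarz.differentiableOn_update_inv`. The Schwarz lemma is then run in its closed form
`ExteriorSchwarz.norm_le_div_mul_norm_of_sphere_bound`: the difference quotient `dslope h 0`
(`= h s / s` off `0`, since `h 0 = 0`) is holomorphic on the same disc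
(`Complex.differentiableOn_dslope`), on the circle `‖s‖ = R₂⁻¹` it is bounded by `L / R₂⁻¹`, so the
maximum modulus principle (`Complex.norm_le_of_forall_mem_frontier_norm_le`) bounds it by `L / R₂⁻¹`
on the closed disc `‖s‖ ≤ R₂⁻¹`, i.e. `‖h s‖ ≤ (L / R₂⁻¹) ‖s‖` there; at `s = c⁻¹` this reads
`‖f c‖ ≤ L R₂ / ‖c‖`. The boundedness hypothesis `hfb` of the registered signature is implied by the
decay hypothesis for this purpose and is not used.

Sources: classical — L. V. Ahlfors, *Complex Analysis* (3rd ed., McGraw-Hill, 1979), Ch. 4 §3.1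
(removable singularities), §3.2 (Schwarz's lemma), §3.4 (the maximum principle).
-/

open scoped Topology
open Filter Set Function Metric Complex

-- the registered namespace `Summit.SmoothPoincare4.SmoothPoincare4.…` repeats a component
set_option linter.dupNamespace false

noncomputable section

namespace Summit.SmoothPoincare4.SmoothPoincare4.Cruxes.TameOrBrodyR4.Sketch

namespace ExteriorSchwarz

/-- **Removable singularity at infinity.** If `f` is holomorphic on the exterior domain
`{R₁ < ‖c‖}` (`0 < R₁`) and tends to `0` at infinity, then its pull-back under the inversion,
`s ↦ f s⁻¹` extended by `0` at `s = 0`, is holomorphic on the disc `ball 0 R₁⁻¹`. -/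
theorem differentiableOn_update_inv (f : ℂ → ℂ) {R₁ : ℝ} (hR₁ : 0 < R₁)
    (hf : DifferentiableOn ℂ f {c | R₁ < ‖c‖}) (hf0 : Tendsto f (cocompact ℂ) (𝓝 0)) :
    DifferentiableOn ℂ (update (fun s : ℂ => f s⁻¹) 0 0) (ball 0 R₁⁻¹) := by
  refine (Complex.differentiableOn_compl_singleton_and_continuousAt_iff
    (ball_mem_nhds (0 : ℂ) (inv_pos.mpr hR₁))).mp ⟨?_, ?_⟩
  · -- off `0` the pull-back is `f ∘ Inv.inv`, a composition of holomorphic maps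
    have hd : DifferentiableOn ℂ (fun s : ℂ => f s⁻¹) (ball 0 R₁⁻¹ \ {0}) := by
      refine hf.comp (differentiableOn_inv.mono fun s hs => hs.2) fun s hs => ?_
      have hs0 : 0 < ‖s‖ := norm_pos_iff.mpr hs.2
      show R₁ < ‖s⁻¹‖
      rw [norm_inv]
      exact (lt_inv_comm₀ hR₁ hs0).mpr (mem_ball_zero_iff.mp hs.1)
    exact hd.congr fun s hs => update_of_ne hs.2 _ _
  · -- at `0`: `f s⁻¹ → 0` as `s → 0`, `s ≠ 0`, because `s⁻¹ → ∞` and `f → 0` at infinity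
    rw [continuousAt_update_same]
    have h1 : Tendsto (Inv.inv : ℂ → ℂ) (𝓝[≠] 0) (cocompact ℂ) := by
      rw [← Metric.cobounded_eq_cocompact]
      exact Filter.tendsto_inv₀_nhdsNE_zero
    exact hf0.comp h1

/-- **Schwarz's lemma, closed form, with the bound read off a circle.** If `h` is holomorphic on the
disc `ball 0 r`, vanishes at `0`, and `‖h s‖ ≤ C` on the circle `‖s‖ = ρ` (`0 < ρ < r`), then
`‖h z‖ ≤ (C / ρ) ‖z‖` for `‖z‖ ≤ ρ`. (Maximum modulus principle applied to the difference quotient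
`dslope h 0`, which is holomorphic by the removable singularity theorem.) -/
theorem norm_le_div_mul_norm_of_sphere_bound {h : ℂ → ℂ} {r ρ C : ℝ} (hρ : 0 < ρ) (hρr : ρ < r)
    (hd : DifferentiableOn ℂ h (ball 0 r)) (h0 : h 0 = 0)
    (hC : ∀ s : ℂ, ‖s‖ = ρ → ‖h s‖ ≤ C) {z : ℂ} (hz : ‖z‖ ≤ ρ) : ‖h z‖ ≤ C / ρ * ‖z‖ := by
  have hr : 0 < r := hρ.trans hρr
  -- the difference quotient at `0` is holomorphic on the disc (removable singularity)
  have hg : DifferentiableOn ℂ (dslope h 0) (ball 0 r) :=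
    (Complex.differentiableOn_dslope (ball_mem_nhds (0 : ℂ) hr)).mpr hd
  have hsg : ∀ s : ℂ, s • dslope h 0 s = h s := fun s => by
    have := sub_smul_dslope h 0 s
    rwa [sub_zero, h0, sub_zero] at this
  have hnorm : ∀ s : ℂ, ‖h s‖ = ‖s‖ * ‖dslope h 0 s‖ := fun s => by
    rw [← hsg s, norm_smul]
  have hgU : DiffContOnCl ℂ (dslope h 0) (ball 0 ρ) :=
    hg.diffContOnCl_ball (closedBall_subset_ball hρr)
  -- on the circle `‖s‖ = ρ` the difference quotient is bounded by `C / ρ`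
  have hfr : ∀ s ∈ frontier (ball (0 : ℂ) ρ), ‖dslope h 0 s‖ ≤ C / ρ := by
    intro s hs
    rw [frontier_ball (0 : ℂ) hρ.ne', mem_sphere_zero_iff_norm] at hs
    rw [le_div_iff₀ hρ, ← hs]
    calc ‖dslope h 0 s‖ * ‖s‖ = ‖h s‖ := by rw [hnorm s]; ring
      _ ≤ C := hC s hs
  -- maximum modulus principle on the closed disc `‖z‖ ≤ ρ`
  have hmax : ‖dslope h 0 z‖ ≤ C / ρ :=
    Complex.norm_le_of_forall_mem_frontier_norm_le isBounded_ball hgU hfr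
      (by rw [closure_ball (0 : ℂ) hρ.ne']; exact mem_closedBall_zero_iff.mpr hz)
  calc ‖h z‖ = ‖z‖ * ‖dslope h 0 z‖ := hnorm z
    _ ≤ ‖z‖ * (C / ρ) := mul_le_mul_of_nonneg_left hmax (norm_nonneg _)
    _ = C / ρ * ‖z‖ := mul_comm _ _

end ExteriorSchwarz

/-- **Stub C2d: the Schwarz lemma at infinity, with the bound read off a circle.** Let `f` be
holomorphic on the exterior domain `{R₁ < ‖c‖}` (`0 < R₁`), bounded there, tending to `0` at
infinity, and with `‖f c‖ ≤ L` on the circle `‖c‖ = R₂` (`R₁ < R₂`). Then `‖f c‖ ≤ L R₂ / ‖c‖`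
for all `‖c‖ ≥ R₂`. Proof: the pull-back `s ↦ f s⁻¹` (value `0` at `0`) is holomorphic on the disc
`‖s‖ < R₁⁻¹` (`ExteriorSchwarz.differentiableOn_update_inv`, removable singularity), vanishes at `0`,
and is bounded by `L` on the circle `‖s‖ = R₂⁻¹`; the closed Schwarz lemma
`ExteriorSchwarz.norm_le_div_mul_norm_of_sphere_bound` at `s = c⁻¹` gives
`‖f c‖ ≤ (L / R₂⁻¹) ‖c⁻¹‖ = L R₂ / ‖c‖`. (The boundedness hypothesis is not needed given the decay
hypothesis.) -/
theorem stub_exteriorSchwarz (f : ℂ → ℂ) (R₁ R₂ L : ℝ) (hR₁ : 0 < R₁) (hR₁₂ : R₁ < R₂)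
    (hf : DifferentiableOn ℂ f {c | R₁ < ‖c‖}) (hfb : ∃ M : ℝ, ∀ c, R₁ < ‖c‖ → ‖f c‖ ≤ M)
    (hf0 : Tendsto f (cocompact ℂ) (𝓝 0)) (hfL : ∀ c : ℂ, ‖c‖ = R₂ → ‖f c‖ ≤ L) :
    ∀ c : ℂ, R₂ ≤ ‖c‖ → ‖f c‖ ≤ L * R₂ / ‖c‖ := by
  obtain ⟨_, _⟩ := hfb -- not needed: `hf0` already provides the continuity at infinity
  intro c hc
  have hR₂ : 0 < R₂ := hR₁.trans hR₁₂
  have hcne : c ≠ 0 := norm_pos_iff.mp (hR₂.trans_le hc)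
  -- the bound `L` on the circle `‖s‖ = R₂⁻¹` for the pull-back `s ↦ f s⁻¹`
  have hC : ∀ s : ℂ, ‖s‖ = R₂⁻¹ → ‖update (fun s : ℂ => f s⁻¹) 0 0 s‖ ≤ L := by
    intro s hs
    have hs0 : s ≠ 0 := norm_pos_iff.mp (by rw [hs]; exact inv_pos.mpr hR₂)
    rw [update_of_ne hs0]
    exact hfL _ (by rw [norm_inv, hs, inv_inv])
  -- the closed Schwarz lemma on the disc `‖s‖ ≤ R₂⁻¹` at `s = c⁻¹`
  have key := ExteriorSchwarz.norm_le_div_mul_norm_of_sphere_bound (inv_pos.mpr hR₂)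
    ((inv_lt_inv₀ hR₂ hR₁).mpr hR₁₂) (ExteriorSchwarz.differentiableOn_update_inv f hR₁ hf hf0)
    (update_self ..) hC (z := c⁻¹) (by rw [norm_inv]; exact inv_anti₀ hR₂ hc)
  have h1 : update (fun s : ℂ => f s⁻¹) 0 0 c⁻¹ = f c := by
    rw [update_of_ne (inv_ne_zero hcne)]
    show f c⁻¹⁻¹ = f c
    rw [inv_inv]
  have h2 : L / R₂⁻¹ * ‖c⁻¹‖ = L * R₂ / ‖c‖ := by
    rw [div_inv_eq_mul, norm_inv, div_eq_mul_inv]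
  rw [h1, h2] at key
  exact key

end Summit.SmoothPoincare4.SmoothPoincare4.Cruxes.TameOrBrodyR4.Sketch
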